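import Literature.NumberTheory.Automorphic.RankinSelbergTorusIntegral
import Literature.NumberTheory.GaloisRepresentations.UnitIdeles
import Mathlib.MeasureTheory.Measure.Haar.Unique
import HarnessLib

/-!
# Integration over the unit-idele torus in the archimedean logarithmic coordinates:
`∫_{(𝕌_K)ⁿ} H(log ‖a_{i,w}‖) dν(a) = c ∫_{ℝ^{n r_∞}} H`
(Tate (1967), §4.3; Cogdell (2004), §2.3: the archimedean factor of a torus integral)

Topic `NumberTheory/Automorphic`; namespace `Literature.NumberTheory.Automorphic`. Proof file
(theorems only). After all the finite places of a torus integral of a factorizable integrand have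
been peeled off (`TorusUnitBoxUnfolding`, `TorusUnitBoxEulerBound`), one is left with an integral over
the unit box `B(all finite places) = (𝕌_K)ⁿ` (`𝕌_K = unitIdeles K`, the ideles that are local units at
every finite place) of a function of the archimedean sizes `‖a_{i,w}‖`, `w ∣ ∞`, only. This file
identifies such integrals with Lebesgue integrals over `ℝ^{n r_∞}` through the logarithmic coordinates
`Λ(a)_{i,w} = log ‖a_{i,w}‖`:

* `idele_norm_fst_pos`, `idele_norm_fst_mul`, `idele_norm_fst_inv` — the archimedean components of an
  idele are non-zero, with multiplicative norms;
* `exists_mem_unitIdeles_norm_fst_eq` — for prescribed sizes `r_w > 0` there is a unit idele with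
  `‖t_w‖ = r_w` (and finite components `1`): the logarithmic coordinates are onto;
* `isCompact_setOf_mem_unitIdeles_norm_le` — `{x ∈ 𝕌_K | ‖x_w‖ ≤ R, ‖x_w⁻¹‖ ≤ R ∀ w}` is compact
  (as `NormOneIdeleClassCompact.isCompact_normBox`);
* `exists_setLIntegral_unitBox_univ_eq_mul_lintegral` (**main**) — for a left-invariant measure `ν` on
  `(𝔸_Kˣ)ⁿ` finite on compact sets there is `c ∈ ℝ≥0` with

    `∫_{B(all)} H(Λ a) dν(a) = c ∫_{ℝ^{n r_∞}} H(u) du`   for every measurable `H ≥ 0`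

  (the image of `ν|_{B(all)}` under `Λ` is translation invariant — translate by unit ideles of
  prescribed archimedean sizes — and finite on compacts, hence a multiple of Lebesgue measure by the
  uniqueness of Haar measure).

## References

* J. Tate, *Fourier analysis in number fields and Hecke's zeta-functions*, in Cassels–Fröhlich (1967),
  Ch. XV §4.3 [CasselsFrohlichANT1967].
* J. W. Cogdell, *Analytic theory of L-functions for GL_n* (2004), §2.3 [CogdellAnalyticTheory2004].
-/

noncomputable section

open MeasureTheory Measure NumberField IsDedekindDomain Set Filter Topology NumberField.InfinitePlace
open Literature.NumberTheory.GaloisRepresentations (ideleGroup unitIdeles infiniteIdeles)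
open scoped ENNReal NNReal Pointwise RestrictedProduct

namespace Literature.NumberTheory.Automorphic

/-! ### Archimedean components of ideles -/

section Arch

variable {K : Type} [Field K] [NumberField K]

/-- `x⁻¹_w x_w = 1` for the archimedean components of an idele. [folklore] -/
theorem idele_inv_fst_mul_fst (x : ideleGroup K) (w : InfinitePlace K) :
    ((x⁻¹ : ideleGroup K) : AdeleRing (𝓞 K) K).1 w * ((x : ideleGroup K) : AdeleRing (𝓞 K) K).1 w = 1 :=
  congrFun (GaloisRepresentations.ideleGroup_val_inv_fst_mul x) w

/-- The archimedean components of an idele are non-zero. Duplicate of `idele_fst_apply_ne_zero`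
(`NormOneIdeleClassCompact`, in the import closure); deprecated restatement (dedup-01127,
2026-08-16). [folklore] -/
@[deprecated idele_fst_apply_ne_zero (since := "2026-08-16")]
theorem idele_fst_ne_zero (x : ideleGroup K) (w : InfinitePlace K) :
    ((x : ideleGroup K) : AdeleRing (𝓞 K) K).1 w ≠ 0 :=
  idele_fst_apply_ne_zero x w

/-- The archimedean components of an idele have positive norm. [folklore] -/
theorem idele_norm_fst_pos (x : ideleGroup K) (w : InfinitePlace K) :
    0 < ‖((x : ideleGroup K) : AdeleRing (𝓞 K) K).1 w‖ :=
  norm_pos_iff.2 (idele_fst_apply_ne_zero x w)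

/-- Norms of archimedean components are multiplicative. [folklore] -/
theorem idele_norm_fst_mul (x y : ideleGroup K) (w : InfinitePlace K) :
    ‖((x * y : ideleGroup K) : AdeleRing (𝓞 K) K).1 w‖ =
      ‖((x : ideleGroup K) : AdeleRing (𝓞 K) K).1 w‖ * ‖((y : ideleGroup K) : AdeleRing (𝓞 K) K).1 w‖ := by
  rw [GaloisRepresentations.ideleGroup_val_fst_mul]
  change ‖((x : ideleGroup K) : AdeleRing (𝓞 K) K).1 w * ((y : ideleGroup K) : AdeleRing (𝓞 K) K).1 w‖ = _
  exact norm_mul _ _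

/-- `‖x⁻¹_w‖ = ‖x_w‖⁻¹`. [folklore] -/
theorem idele_norm_fst_inv (x : ideleGroup K) (w : InfinitePlace K) :
    ‖((x⁻¹ : ideleGroup K) : AdeleRing (𝓞 K) K).1 w‖ = ‖((x : ideleGroup K) : AdeleRing (𝓞 K) K).1 w‖⁻¹ := by
  have h := idele_inv_fst_mul_fst x w
  have h' := congrArg (fun z => ‖z‖) h
  simp only [norm_mul, norm_one] at h'
  exact eq_inv_of_mul_eq_one_left h'

omit [NumberField K] in
/-- **Every positive real is the norm of an element of `K_w`** (for `w` real the completion is `ℝ`,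
for `w` complex it is `ℂ`, both isometrically). [folklore] -/
theorem exists_norm_eq_of_infinitePlace (w : InfinitePlace K) {r : ℝ} (hr : 0 ≤ r) :
    ∃ x : w.Completion, ‖x‖ = r := by
  rcases isReal_or_isComplex w with hw | hw
  · obtain ⟨x, hx⟩ := Completion.surjective_extensionEmbeddingOfIsReal hw r
    refine ⟨x, ?_⟩
    have hiso := (Completion.isometry_extensionEmbeddingOfIsReal hw).norm_map_of_map_zero (map_zero _) x
    rw [hx, Real.norm_of_nonneg hr] at hiso
    exact hiso.symm
  · obtain ⟨x, hx⟩ := Completion.surjective_extensionEmbedding_of_isComplex hw (r : ℂ)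
    refine ⟨x, ?_⟩
    have hiso := (Completion.isometry_extensionEmbedding w).norm_map_of_map_zero (map_zero _) x
    rw [hx, Complex.norm_real, Real.norm_of_nonneg hr] at hiso
    exact hiso.symm

/-- **Unit ideles of prescribed archimedean sizes**: for `r_w > 0` there is `t ∈ 𝕌_K` (finite
components `1`) with `‖t_w‖ = r_w` for every infinite place `w`. [folklore] -/
theorem exists_mem_unitIdeles_norm_fst_eq (r : InfinitePlace K → ℝ) (hr : ∀ w, 0 < r w) :
    ∃ t : ideleGroup K, t ∈ unitIdeles K ∧
      ∀ w : InfinitePlace K, ‖((t : ideleGroup K) : AdeleRing (𝓞 K) K).1 w‖ = r w := by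
  choose x hx using fun w : InfinitePlace K => exists_norm_eq_of_infinitePlace w (hr w).le
  have hx0 : ∀ w, x w ≠ 0 := fun w h => by
    have := hx w; rw [h, norm_zero] at this; exact (hr w).ne' this.symm
  -- the archimedean unit with components `x w`
  set z : (InfiniteAdeleRing K)ˣ :=
    (MulEquiv.piUnits (M := fun w : InfinitePlace K => w.Completion)).symm fun w => Units.mk0 (x w) (hx0 w) with hz
  refine ⟨infiniteIdeles K z, fun v => ?_, fun w => ?_⟩
  · -- finite components are `1`
    change Valued.v ((1 : FiniteAdeleRing (𝓞 K) K) v) = 1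
    exact map_one _
  · change ‖((z : InfiniteAdeleRing K)) w‖ = r w
    rw [← hx w]
    rfl

/-! ### Compactness of the bounded part of the unit ideles -/

/-- **`{x ∈ 𝕌_K | ‖x_w‖ ≤ R, ‖(x⁻¹)_w‖ ≤ R' for all w ∣ ∞}` is compact** (a closed subset of the
compact `C_R × C_{R'}` under the units embedding into `𝔸 × 𝔸ᵐᵒᵖ`, `C_R` the integral adeles of
archimedean size `≤ R`; as `isCompact_normBox`). [folklore] -/
theorem isCompact_setOf_mem_unitIdeles_norm_le (R R' : ℝ) :
    IsCompact {x : ideleGroup K | x ∈ unitIdeles K ∧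
      ∀ w : InfinitePlace K, ‖((x : ideleGroup K) : AdeleRing (𝓞 K) K).1 w‖ ≤ R ∧
        ‖((x⁻¹ : ideleGroup K) : AdeleRing (𝓞 K) K).1 w‖ ≤ R'} := by
  haveI : T2Space (InfiniteAdeleRing K) :=
    inferInstanceAs (T2Space ((v : InfinitePlace K) → v.Completion))
  haveI : T2Space (FiniteAdeleRing (𝓞 K) K) := inferInstanceAs
    (T2Space (Πʳ v : HeightOneSpectrum (𝓞 K), [v.adicCompletion K, v.adicCompletionIntegers K]))
  haveI : T2Space (AdeleRing (𝓞 K) K) :=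
    inferInstanceAs (T2Space (InfiniteAdeleRing K × FiniteAdeleRing (𝓞 K) K))
  let C : ℝ → Set (AdeleRing (𝓞 K) K) := fun R => {a | (∀ v : HeightOneSpectrum (𝓞 K),
      a.2 v ∈ v.adicCompletionIntegers K) ∧ ∀ w : InfinitePlace K, ‖a.1 w‖ ≤ R}
  have hC : ∀ R, IsCompact (C R) := fun R => isCompact_integralAdeles_norm_le K R
  have hbig : IsCompact ((C R) ×ˢ (MulOpposite.op '' (C R'))) :=
    (hC R).prod ((hC R').image MulOpposite.continuous_op)
  have hcl1 : IsClosed {p : AdeleRing (𝓞 K) K × (AdeleRing (𝓞 K) K)ᵐᵒᵖ | p.1 * p.2.unop = 1} :=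
    isClosed_eq (continuous_fst.mul (MulOpposite.continuous_unop.comp continuous_snd))
      continuous_const
  have hK : IsCompact (((C R) ×ˢ (MulOpposite.op '' (C R'))) ∩ {p | p.1 * p.2.unop = 1}) :=
    hbig.inter_right hcl1
  rw [Units.isEmbedding_embedProduct.isCompact_iff]
  convert hK using 1
  ext ⟨a, b⟩
  simp only [Set.mem_image, Set.mem_inter_iff, Set.mem_prod, Set.mem_setOf_eq]
  constructor
  · rintro ⟨x, ⟨hunit, hinf⟩, hx⟩
    rw [Units.embedProduct_apply] at hx
    obtain ⟨rfl, rfl⟩ := Prod.mk_inj.mp hx.symm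
    have hfin := GaloisRepresentations.mem_unitIdeles_iff_mem_and_inv_mem.1 hunit
    refine ⟨⟨⟨fun v => hfin.1 v, fun w => (hinf w).1⟩, ⟨((x⁻¹ : (AdeleRing (𝓞 K) K)ˣ) :
      AdeleRing (𝓞 K) K), ⟨fun v => hfin.2 v, fun w => (hinf w).2⟩, rfl⟩⟩, ?_⟩
    simp only [MulOpposite.unop_op, Units.mul_inv]
  · rintro ⟨⟨⟨ha1, ha2⟩, ⟨b', ⟨hb1, hb2⟩, rfl⟩⟩, hab⟩
    simp only [MulOpposite.unop_op] at hab
    refine ⟨⟨a, b', hab, by rw [mul_comm]; exact hab⟩, ⟨?_, fun w => ⟨ha2 w, hb2 w⟩⟩, rfl⟩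
    exact GaloisRepresentations.mem_unitIdeles_iff_mem_and_inv_mem.2 ⟨fun v => ha1 v, fun v => hb1 v⟩

end Arch

/-! ### The unit-idele torus and its archimedean logarithmic coordinates -/

section Torus

variable {n : ℕ} {K : Type} [Field K] [NumberField K]
variable [MeasurableSpace (ideleGroup K)] [BorelSpace (ideleGroup K)]

attribute [local instance] secondCountableTopology_ideleGroup

omit [MeasurableSpace (ideleGroup K)] [BorelSpace (ideleGroup K)] in
/-- The unit box at all finite places is `(𝕌_K)ⁿ`. [folklore] -/
theorem mem_unitBox_univ_iff (a : Fin n → ideleGroup K) :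
    a ∈ unitBox (n := n) (K := K) Set.univ ↔ ∀ i, a i ∈ unitIdeles K :=
  ⟨fun h i v => h v (Set.mem_univ v) i, fun h v _ i => h i v⟩

omit [MeasurableSpace (ideleGroup K)] [BorelSpace (ideleGroup K)] in
/-- `(𝕌_K)ⁿ` is stable under multiplication by its elements. [folklore] -/
theorem mul_mem_unitBox_univ_iff {t : Fin n → ideleGroup K} (ht : t ∈ unitBox (n := n) (K := K) Set.univ)
    (a : Fin n → ideleGroup K) :
    t * a ∈ unitBox (n := n) (K := K) Set.univ ↔ a ∈ unitBox (n := n) (K := K) Set.univ := by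
  rw [mem_unitBox_univ_iff, mem_unitBox_univ_iff] at *
  refine ⟨fun h i => ?_, fun h i => (unitIdeles K).mul_mem (ht i) (h i)⟩
  have h1 := (unitIdeles K).mul_mem ((unitIdeles K).inv_mem (ht i)) (h i)
  rwa [Pi.mul_apply, inv_mul_cancel_left] at h1

omit [MeasurableSpace (ideleGroup K)] [BorelSpace (ideleGroup K)] in
/-- Continuity of the logarithmic archimedean coordinates `a ↦ (log ‖a_{i,w}‖)_{i,w}`. [folklore] -/
theorem continuous_archLog :
    Continuous fun (a : Fin n → ideleGroup K) (p : Fin n × InfinitePlace K) =>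
      Real.log ‖((a p.1 : ideleGroup K) : AdeleRing (𝓞 K) K).1 p.2‖ := by
  refine continuous_pi fun p => ?_
  have hc : Continuous fun a : Fin n → ideleGroup K => ((a p.1 : ideleGroup K) : AdeleRing (𝓞 K) K).1 p.2 :=
    (continuous_apply p.2).comp (continuous_fst.comp (Units.continuous_val.comp (continuous_apply p.1)))
  exact (continuous_norm.comp hc).log fun a => (idele_norm_fst_pos (a p.1) p.2).ne'

omit [MeasurableSpace (ideleGroup K)] [BorelSpace (ideleGroup K)] in
/-- The logarithmic coordinates turn multiplication into addition. [folklore] -/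
theorem archLog_mul (t a : Fin n → ideleGroup K) :
    (fun p : Fin n × InfinitePlace K => Real.log ‖(((t * a) p.1 : ideleGroup K) : AdeleRing (𝓞 K) K).1 p.2‖) =
      (fun p => Real.log ‖((t p.1 : ideleGroup K) : AdeleRing (𝓞 K) K).1 p.2‖) +
        fun p => Real.log ‖((a p.1 : ideleGroup K) : AdeleRing (𝓞 K) K).1 p.2‖ := by
  funext p
  simp only [Pi.add_apply, Pi.mul_apply]
  rw [idele_norm_fst_mul, Real.log_mul (idele_norm_fst_pos _ p.2).ne' (idele_norm_fst_pos _ p.2).ne']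

variable (νA : Measure (Fin n → ideleGroup K)) [νA.IsMulLeftInvariant] [IsFiniteMeasureOnCompacts νA]

/-- **Integration over `(𝕌_K)ⁿ` in the logarithmic archimedean coordinates.** For a left-invariant
measure `ν` on the torus `(𝔸_Kˣ)ⁿ` which is finite on compact sets there is `c ∈ ℝ≥0` such that for
every measurable `H ≥ 0` on `ℝ^{n r_∞}`,

  `∫_{B(all finite places)} H((log ‖a_{i,w}‖)_{(i,w)}) dν(a) = c ∫ H(u) du`

(`du` Lebesgue measure on `ℝ^{Fin n × {w ∣ ∞}}`). Proof: the image of `ν|_{(𝕌_K)ⁿ}` under the coordinates is translation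
invariant (`exists_mem_unitIdeles_norm_fst_eq`) and finite on compacts
(`isCompact_setOf_mem_unitIdeles_norm_le`), hence a multiple of Lebesgue measure
(`Measure.isAddLeftInvariant_eq_smul`). [folklore] -/
theorem exists_setLIntegral_unitBox_univ_eq_mul_lintegral :
    ∃ c : ℝ≥0, ∀ (H : (Fin n × InfinitePlace K → ℝ) → ℝ≥0∞), Measurable H →
      ∫⁻ a in unitBox (n := n) (K := K) Set.univ,
          H (fun p => Real.log ‖((a p.1 : ideleGroup K) : AdeleRing (𝓞 K) K).1 p.2‖) ∂νA =
        c * ∫⁻ u, H u := by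
  set U : Set (Fin n → ideleGroup K) := unitBox (n := n) (K := K) Set.univ with hU
  have hUm : MeasurableSet U := measurableSet_unitBox _
  set Λ : (Fin n → ideleGroup K) → (Fin n × InfinitePlace K → ℝ) :=
    fun a p => Real.log ‖((a p.1 : ideleGroup K) : AdeleRing (𝓞 K) K).1 p.2‖ with hΛ
  have hΛc : Continuous Λ := continuous_archLog
  have hΛm : Measurable Λ := hΛc.measurable
  set ρ : Measure (Fin n × InfinitePlace K → ℝ) := (νA.restrict U).map Λ with hρ
  -- translation invariance
  haveI : ρ.IsAddLeftInvariant := by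
    refine ⟨fun u => ?_⟩
    -- unit ideles with archimedean sizes `exp (u i w)`
    choose t ht htn using fun i : Fin n => exists_mem_unitIdeles_norm_fst_eq (K := K)
      (fun w => Real.exp (u (i, w))) (fun w => Real.exp_pos _)
    have htU : t ∈ U := (mem_unitBox_univ_iff t).2 ht
    have hu : (fun p : Fin n × InfinitePlace K => Real.log ‖((t p.1 : ideleGroup K) : AdeleRing (𝓞 K) K).1 p.2‖) = u := by
      funext p
      rw [htn p.1 p.2, Real.log_exp]
    have hΛt : ∀ a, Λ (t * a) = u + Λ a := by
      intro a
      have key := archLog_mul t a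
      rw [hu] at key
      exact key
    have hcomp : ((fun x => u + x) ∘ Λ) = Λ ∘ fun a => t * a := by
      funext a; simp only [Function.comp_apply, hΛt]
    have hpre : (fun a => t * a) ⁻¹' U = U := by
      ext a; exact mul_mem_unitBox_univ_iff htU a
    rw [hρ, Measure.map_map (measurable_const_add u) hΛm, hcomp, ← Measure.map_map hΛm (measurable_const_mul t)]
    congr 1
    conv_lhs => rw [← hpre]
    rw [← Measure.restrict_map (measurable_const_mul t) hUm, map_mul_left_eq_self]
  -- finite on compacts
  haveI : IsFiniteMeasureOnCompacts ρ := by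
    refine ⟨fun C hC => ?_⟩
    obtain ⟨R, hR⟩ : ∃ R : ℝ, ∀ u ∈ C, ‖u‖ ≤ R := by
      obtain ⟨R, hR⟩ := hC.isBounded.subset_closedBall (0 : Fin n × InfinitePlace K → ℝ)
      exact ⟨R, fun u hu => by simpa using hR hu⟩
    rw [hρ, Measure.map_apply hΛm hC.measurableSet, Measure.restrict_apply (hΛm hC.measurableSet)]
    set S : Set (ideleGroup K) := {x : ideleGroup K | x ∈ unitIdeles K ∧
      ∀ w : InfinitePlace K, ‖((x : ideleGroup K) : AdeleRing (𝓞 K) K).1 w‖ ≤ Real.exp R ∧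
        ‖((x⁻¹ : ideleGroup K) : AdeleRing (𝓞 K) K).1 w‖ ≤ Real.exp R} with hS
    have hSc : IsCompact S := isCompact_setOf_mem_unitIdeles_norm_le (Real.exp R) (Real.exp R)
    have hsub : Λ ⁻¹' C ∩ U ⊆ Set.pi Set.univ fun _ : Fin n => S := by
      rintro a ⟨haC, haU⟩ i -
      have hai : a i ∈ unitIdeles K := (mem_unitBox_univ_iff a).1 haU i
      refine ⟨hai, fun w => ?_⟩
      have h1 : |Λ a (i, w)| ≤ R := by
        have h2 : ‖Λ a‖ ≤ R := hR _ haC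
        have h3 : ‖Λ a (i, w)‖ ≤ ‖Λ a‖ := norm_le_pi_norm (Λ a) (i, w)
        rw [Real.norm_eq_abs] at h3
        exact h3.trans h2
      rw [abs_le] at h1
      have hpos := idele_norm_fst_pos (a i) w
      constructor
      · exact (Real.log_le_iff_le_exp hpos).1 h1.2
      · rw [idele_norm_fst_inv]
        rw [inv_le_iff_one_le_mul₀ hpos, ← Real.exp_log hpos, ← Real.exp_add]
        exact Real.one_le_exp (by linarith [h1.1])
    exact (measure_mono hsub).trans_lt (isCompact_univ_pi fun _ => hSc).measure_lt_top
  -- uniqueness of Haar measure on `ℝ^{n r}`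
  refine ⟨ρ.addHaarScalarFactor volume, fun H hH => ?_⟩
  have hρeq : ρ = ρ.addHaarScalarFactor volume • (volume : Measure (Fin n × InfinitePlace K → ℝ)) :=
    Measure.isAddLeftInvariant_eq_smul ρ volume
  calc ∫⁻ a in U, H (Λ a) ∂νA = ∫⁻ u, H u ∂ρ := by rw [hρ, lintegral_map hH hΛm]
    _ = ρ.addHaarScalarFactor volume * ∫⁻ u, H u := by
        conv_lhs => rw [hρeq]
        rw [lintegral_smul_measure, ENNReal.smul_def, smul_eq_mul]

end Torus

end Literature.NumberTheory.Automorphic
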